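import Summits.CriticalPhenomena.CardyFormulaZ2.Theorems.CardyIKTransportIKMixedBoxCrossingQuenchedMixtureDefs

/-!
# Line `defect-closure-exploration` v7 / ALT line `quenched-chain-fkg` — VOCABULARY of the CONCENTRATION layer behind `ApproxHarrisFam`
# (crux `IKMixedBoxCrossing`, stmt-CriticalPhenomena-5911; lead c7; card `Lines/quenched-chain-fkg.md` §3)

Definitions-only support file (`--supports stmt-CriticalPhenomena-5911`).  Nothing is asserted: every `def … : Prop` is a statement the LINE
POSITS (a registered stub), never a literature fact.

After `…QuenchedMixtureDefs.lean` ((C), (M), (L), (H), (A): the free colour law of a box is the exact average over the colourless environment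
`ξ = (D, v)` of quenched weights, each Harris–FKG, so that `colourLaw(∩ 𝒜_i) ≥ E_ξ ∏ P_ξ(𝒜_i)` for increasing families), the open stub
`stub_approxHarrisFam` splits into
* a PROVABLE composition `ApproxHarrisFamOfVariance : QuenchedMixture → QuenchedHarris → QuenchedVarianceDecay → ApproxHarrisFam` (bridge
  `μIK ↔ boxLaw` (landed `stub_bridgeLaw`), the box events as increasing black-set families at FIXED coins (`boxFamily`), the annealed bound (A)
  coin by coin, and the telescoping `E ∏ X_i ≥ ∏ E X_i − Σ_i sd X_i` for `[0,1]`-valued `X_i`), and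
* the GENUINELY OPEN concentration statement `QuenchedVarianceDecay` (V): the environment variance (over defects, patterns AND coins) of the
  quenched crossing probability of an `n`-box tends to `0` uniformly in the pattern `S`, the box (kind, aspect among those used, position) and
  the enclosing volume — numerically `Var ≍ n^{-1/2}` (card §2: univ .0078/.0055/.0039/.0025 at n = 8…64; alt smaller).
-/

noncomputable section

namespace Summit.CriticalPhenomena.CardyFormulaZ2.Cruxes.IKMixedBoxCrossing.QuenchedChainFKG

open scoped Classical BigOperators
open Finset MeasureTheory
open Literature.Probability.LatticeModels
open Summit.CriticalPhenomena.CardyFormulaZ2.Theorems.IKLinearTransport.PinnedDiagramExchange (Obs lrCross tbCross)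
open Summit.CriticalPhenomena.CardyFormulaZ2.Cruxes.IKMixedBoxCrossing.DefectClosureExploration (facesIn cellRect)

/-! ## §1 Box events as black-set families at fixed coins; quenched crossing probabilities; the environment variance -/

/-- The observable pair (black cells, anti-diagonal faces) of the finite configuration "black exactly on `s`, anti coin exactly on `c`" for
the pattern `S` (anti-diagonal forced off `S`, chosen by the coin on `S` — verbatim the gauge's `anti`). -/
def finObs (S : Set ℤ) (s c : Finset (Site 2)) : Obs :=
  ((↑s : Set (Site 2)), {f | f 0 ∉ S ∨ f ∈ c})

/-- The BLACK-SET FAMILY of the box event `bs` inside `Λ` at fixed anti coins `c`: black sets `s ⊆ Λ` whose configuration realises the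
crossing (increasing in `s` at fixed `c`: crossing events are increasing in the black cells for a fixed triangulation). -/
def boxFamily (S : Set ℤ) (Λ : Finset (Site 2)) (bs : BoxSpec) (c : Finset (Site 2)) : Finset (Finset (Site 2)) :=
  Λ.powerset.filter fun s =>
    finObs S s c ∈ (if bs.lr then lrCross bs.a bs.b bs.w bs.h else tbCross bs.a bs.b bs.w bs.h)

/-- The QUENCHED CROSSING PROBABILITY of the box `bs` in the environment `(D, v)` at coins `c`. -/
def quenchedBoxProb (S : Set ℤ) (Λ : Finset (Site 2)) (bs : BoxSpec) (D : Finset (Site 2))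
    (v : Finset (Site 2) → Finset (Site 2)) (c : Finset (Site 2)) : ℝ :=
  quenchedProb D Λ v (boxFamily S Λ bs c)

/-- The ENVIRONMENT VARIANCE of the quenched crossing probability of `bs` in the volume `Λ`, about the annealed crossing probability
`boxProb S bs`, over fair coins on the `S`-faces of `Λ`, Bernoulli(ρ) defects and uniform patterns (weights `2^{-|facesIn S Λ|} · envW`). -/
def envVariance (S : Set ℤ) (Λ : Finset (Site 2)) (bs : BoxSpec) : ℝ :=
  ∑ c ∈ (facesIn S Λ).powerset, ((1 : ℝ) / 2) ^ (facesIn S Λ).card *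
    ∑ D ∈ (facesIn S Λ).powerset, ∑ v ∈ patterns D, envW S Λ D * (quenchedBoxProb S Λ bs D v c - boxProb S bs) ^ 2

/-- The box of `bs` lies inside the cell rectangle `[a, a+W) × [b, b+H)`. -/
def BoxSpec.Inside (bs : BoxSpec) (a b : ℤ) (W H : ℕ) : Prop :=
  a ≤ bs.a ∧ bs.a + bs.w ≤ a + W ∧ b ≤ bs.b ∧ bs.b + bs.h ≤ b + H

/-! ## §2 The statements the programme POSITS (stubs) -/

/-- (V) QUENCHED VARIANCE DECAY — THE OPEN CONCENTRATION STATEMENT of the line: the environment variance of the quenched crossing probability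
of a box at least `n₀ × n₀` is at most `η`, uniformly in the pattern, the box and the enclosing cell rectangle.  (Card §3 programme: Efron–Stein
over environment sites, influences = two-replica co-pivotality, quenched arm estimates by induction on scales.)  A statement to be proved
(registered stub), not asserted here. -/
def QuenchedVarianceDecay : Prop :=
  ∀ η : ℝ, 0 < η → ∃ n₀ : ℕ, ∀ (S : Set ℤ) (a b : ℤ) (W H : ℕ) (bs : BoxSpec), n₀ ≤ bs.w → n₀ ≤ bs.h →
    bs.Inside a b W H → envVariance S (cellRect a b W H) bs ≤ η

/-- (F) THE PROVABLE COMPOSITION: exact mixture (M) + quenched Harris (H) + variance decay (V) ⇒ `ApproxHarrisFam` (via the landed bridge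
`μIK ↔ boxLaw`, coin-by-coin application of the annealed bound, and `E ∏ X_i ≥ ∏ E X_i − Σ_i sd X_i`).  A statement to be proved
(registered stub), not asserted here. -/
def ApproxHarrisFamOfVariance : Prop :=
  QuenchedMixture → QuenchedHarris → QuenchedVarianceDecay → ApproxHarrisFam

namespace Registered
/-- Alias keyed by the registered stub name. -/
abbrev stub_quenchedVarianceDecay : Prop := QuenchedVarianceDecay
/-- Alias keyed by the registered stub name. -/
abbrev stub_approxHarrisFamOfVariance : Prop := ApproxHarrisFamOfVariance
end Registered

/-- **`ApproxHarrisFam` from the quenched-mixture layer and the concentration statement** (registered composition, sorry-free):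
(M), (L), (H) of `…QuenchedMixtureDefs.lean`, the composition (F) and the open (V) give `ApproxHarrisFam`. -/
theorem approxHarrisFam_of_quenchedLayer :
    Registered.stub_quenchedMixture → Registered.stub_quenchedLogSupermodular → Registered.stub_quenchedHarris →
      Registered.stub_approxHarrisFamOfVariance → Registered.stub_quenchedVarianceDecay → ApproxHarrisFam :=
  fun hM hL hH hF hV => hF hM (hH hL) hV

/-! ## §3 Elementary sanity facts (sorry-free) -/

/-- The black-set family of a box event consists of subsets of the volume. -/
theorem boxFamily_subset (S : Set ℤ) (Λ : Finset (Site 2)) (bs : BoxSpec) (c : Finset (Site 2)) :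
    boxFamily S Λ bs c ⊆ Λ.powerset :=
  Finset.filter_subset _ _

/-- The environment variance is a sum of nonnegative terms whenever the environment weights are nonnegative. -/
theorem envVariance_nonneg {S : Set ℤ} {Λ : Finset (Site 2)} (bs : BoxSpec)
    (h : ∀ D ∈ (facesIn S Λ).powerset, 0 ≤ envW S Λ D) : 0 ≤ envVariance S Λ bs := by
  unfold envVariance
  refine Finset.sum_nonneg fun c _ => mul_nonneg (by positivity) (Finset.sum_nonneg fun D hD => Finset.sum_nonneg fun v _ => ?_)
  exact mul_nonneg (h D hD) (sq_nonneg _)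

end Summit.CriticalPhenomena.CardyFormulaZ2.Cruxes.IKMixedBoxCrossing.QuenchedChainFKG

end
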